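import Summits.CriticalPhenomena.Ising3D.Control2DOpeConvergenceFree
import Mathlib.Analysis.Normed.Group.FunctionSeries
import Mathlib.Analysis.SpecialFunctions.Pow.Continuity
import Mathlib.Tactic.Linarith
import Mathlib.Tactic.Positivity
import HarnessLib

/-!
# The four-point function of every unitary typed solution is continuous on the real open square; the expansion converges
# locally uniformly
(cell `pub-ising3x`, seat controls-1 gen 44; PAPER §6.2 / Appendix E — CONTROL-ONLY; sequel to `Control2DFourPoint` (gen 42) and
`Control2DOpeConvergenceFree` (gen 43))

HONEST FRAMING: lottery ticket; floor = tightest certified 3D Ising CFT bounds; no exact-solution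
claim without a proof. CONTROL-ONLY (`d = 2`, global `sl(2) × sl(2)` blocks, `Δ_σ = s` an INPUT, axiom set
`A2D′`); nothing here is about `d = 3`, no certificate, functional or number of the record is touched, and no
new hypothesis or named fact enters.

WHAT THIS FILE ADDS. The typed class imposes the `⟨σσσσ⟩` sum rule as a POINTWISE identity on the real open square and
`Control2DFourPoint` / `Control2DOpeConvergenceFree` derived absolute convergence of the `s`-channel expansion
`G(z,z̄) = 1 + Σ p_i g_i(z,z̄)` at every point (for every unitary solution at `Δ_σ > 0`), leaving «uniformity of convergence» and
every regularity statement about `G` NOT claimed. Here, by the Weierstrass M-test with the majorants the tree already holds: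

* `continuousOn_chiralBlock (hh : 0 ≤ h) : ContinuousOn (chiralBlock h) (Ioo 0 1)` — the chiral series `Σ a_m(h) x^{h+m}`
  (`hasSum_chiralBlock`, coefficients `≥ 0`) is dominated on `(0, b)`, `b < 1`, by its value at `b` (`continuousOn_chiralBlock_Ioo`);
* `continuousOn_globalBlock (hΔ : ℓ ≤ Δ)` — the block `g_{Δ,ℓ}` is jointly continuous on `(0,1)²`;
* **`CrossingData.tendstoUniformlyOn_expansion`** — for unitary data with convergent expansion the partial sums of
  `Σ p_i g_i(z,z̄)` converge UNIFORMLY on every sub-square `(0,b)²`, `b < 1` (majorant `p_i g_i(b,b)`, `globalBlock_mono`);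
* **`CrossingData.continuousOn_fourPoint (hU) (hconv) : ContinuousOn (fun p => G(p.1,p.2)) (Ioo 0 1 ×ˢ Ioo 0 1)`** and, with
  gen 43's `opeConvergent_free`, **`continuousOn_fourPoint_free (hU) (hC) (hs : 0 < s)`**: the four-point function of EVERY unitary
  solution of the typed sum rule at `Δ_σ > 0` is (jointly) continuous on the real open square — so the crossing identity
  `v^s G(z,z̄) = u^s G(1-z,1-z̄)` of `fourPoint_crossing_free` is an identity between continuous functions there;
  `continuousOn_fourPoint_diag` (the diagonal restriction `x ↦ G(x,x)` on `(0,1)`), `continuousOn_fourPoint_eighth` (`Δ_σ = 1/8`).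

NOT claimed: differentiability or real-analyticity of `G` (every block is real-analytic, but no termwise differentiation of the
expansion is asserted here — the Taylor-functional kernel path `Control2DTaylorTermwise` handles derivatives at a point by its
own germ M-test); anything off the REAL open square (no complex domain); boundary behaviour at the edges of the square beyond the
growth bounds of `Control2DFourPointBounds` / `Control2DConvergenceRate`; Virasoro; anything three-dimensional; any new bound.

References: R. Rattazzi, V. S. Rychkov, E. Tonni, A. Vichi, JHEP 12 (2008) 031, §3 [cite: RattazziEtAl2008, §3]; D. Pappadopulo,
S. Rychkov, J. Espin, R. Rattazzi, Phys. Rev. D 86 (2012) 105043, §4 (uniform convergence of the OPE on compacts — there from the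
Hilbert-space structure, here from the typed sum rule) [cite: PappadopuloRychkovEspinRattazzi2012PRD, §4.1]; F. A. Dolan, H. Osborn,
Nucl. Phys. B 678 (2004) 491, §3 [cite: DolanOsborn2004, §3]. Tree: `hasSum_chiralBlock`, `chiralCoeff_nonneg` (`Control2DTermwise`);
`globalBlock_nonneg`, `globalBlock_mono`, `fourPoint` (`Control2DFourPoint`); `opeConvergent_free` (`Control2DOpeConvergenceFree`).
Mathlib: `continuousOn_tsum`, `tendstoUniformlyOn_tsum`, `Real.continuous_rpow_const`, `IsOpen.continuousOn_iff`.
-/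

namespace Summit.CriticalPhenomena.Ising3D.Control2D

open Set Filter
open Literature.MathematicalPhysics.QuantumFieldTheory.ConformalBootstrap3D

/-! ### Continuity of the blocks -/

/-- **The chiral block is continuous on `(0,b)`, `b < 1`** (M-test: `|a_m x^{h+m}| ≤ a_m b^{h+m}` for `0 < x < b`, and
`Σ a_m b^{h+m} = k_{2h}(b)` converges). [folklore] -/
theorem continuousOn_chiralBlock_Ioo {h b : ℝ} (hh : 0 ≤ h) (hb0 : 0 < b) (hb1 : b < 1) :
    ContinuousOn (chiralBlock h) (Ioo 0 b) := by
  have hS : Summable fun m : ℕ => chiralCoeff h m * b ^ (h + (m : ℝ)) := (hasSum_chiralBlock h hb0 hb1).summable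
  have hcont : ContinuousOn (fun x : ℝ => ∑' m : ℕ, chiralCoeff h m * x ^ (h + (m : ℝ))) (Ioo 0 b) := by
    refine continuousOn_tsum (fun m => ?_) hS (fun m x hx => ?_)
    · have hm : 0 ≤ h + (m : ℝ) := by positivity
      exact (continuous_const.mul (Real.continuous_rpow_const hm)).continuousOn
    · rw [Real.norm_eq_abs, abs_of_nonneg (mul_nonneg (chiralCoeff_nonneg hh m) (Real.rpow_nonneg hx.1.le _))]
      exact mul_le_mul_of_nonneg_left (Real.rpow_le_rpow hx.1.le hx.2.le (by positivity)) (chiralCoeff_nonneg hh m)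
  exact hcont.congr fun x hx => ((hasSum_chiralBlock h hx.1 (hx.2.trans hb1)).tsum_eq).symm

/-- **The chiral block `k_{2h}`, `h ≥ 0`, is continuous on `(0,1)`** (locally, `continuousOn_chiralBlock_Ioo` with `b = (x+1)/2`).
[folklore] -/
theorem continuousOn_chiralBlock {h : ℝ} (hh : 0 ≤ h) : ContinuousOn (chiralBlock h) (Ioo 0 1) := by
  refine isOpen_Ioo.continuousOn_iff.mpr fun x hx => ?_
  have hb0 : 0 < (x + 1) / 2 := by linarith [hx.1]
  have hb1 : (x + 1) / 2 < 1 := by linarith [hx.2]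
  exact isOpen_Ioo.continuousOn_iff.mp (continuousOn_chiralBlock_Ioo hh hb0 hb1) ⟨hx.1, by linarith [hx.2]⟩

/-- **The global block of a unitary label is jointly continuous on the open square** `(0,1)²` (sums of products of continuous
chiral factors in each variable). [folklore] -/
theorem continuousOn_globalBlock {Δ : ℝ} {ℓ : ℕ} (hΔ : (ℓ : ℝ) ≤ Δ) :
    ContinuousOn (fun p : ℝ × ℝ => globalBlock Δ ℓ p.1 p.2) (Ioo (0 : ℝ) 1 ×ˢ Ioo (0 : ℝ) 1) := by
  have hℓ : (0 : ℝ) ≤ ℓ := Nat.cast_nonneg ℓ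
  have hh : 0 ≤ (Δ + ℓ) / 2 := by linarith
  have hhb : 0 ≤ (Δ - ℓ) / 2 := by linarith
  have h1 : MapsTo (Prod.fst : ℝ × ℝ → ℝ) (Ioo (0 : ℝ) 1 ×ˢ Ioo (0 : ℝ) 1) (Ioo 0 1) := fun p hp => hp.1
  have h2 : MapsTo (Prod.snd : ℝ × ℝ → ℝ) (Ioo (0 : ℝ) 1 ×ˢ Ioo (0 : ℝ) 1) (Ioo 0 1) := fun p hp => hp.2
  have A1 := (continuousOn_chiralBlock hh).comp continuousOn_fst h1
  have A2 := (continuousOn_chiralBlock hh).comp continuousOn_snd h2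
  have B1 := (continuousOn_chiralBlock hhb).comp continuousOn_fst h1
  have B2 := (continuousOn_chiralBlock hhb).comp continuousOn_snd h2
  exact (A1.mul B2).add (B1.mul A2)

/-! ### The four-point function -/

namespace CrossingData

variable {D : CrossingData} {s : ℝ}

/-- **Uniform convergence of the expansion on sub-squares**: for unitary data with convergent expansion and `0 < b < 1`, the
partial sums of `Σ_i p_i g_i(z,z̄)` converge uniformly on `(0,b)²` (M-test with the majorant `p_i g_i(b,b)`, `globalBlock_mono`).
[cite: PappadopuloRychkovEspinRattazzi2012PRD, §4.1] -/
theorem tendstoUniformlyOn_expansion (hU : D.IsUnitary) (hconv : D.OpeConvergent) {b : ℝ} (hb0 : 0 < b) (hb1 : b < 1) :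
    TendstoUniformlyOn (fun t : Finset D.ι => fun p : ℝ × ℝ => ∑ i ∈ t, D.p i * globalBlock (D.Δ i) (D.spin i) p.1 p.2)
      (fun p => ∑' i, D.p i * globalBlock (D.Δ i) (D.spin i) p.1 p.2) atTop (Ioo (0 : ℝ) b ×ˢ Ioo (0 : ℝ) b) := by
  have hbI : b ∈ Ioo (0 : ℝ) 1 := ⟨hb0, hb1⟩
  refine tendstoUniformlyOn_tsum (hconv b b hbI hbI) fun i p hp => ?_
  have h1 : p.1 ∈ Ioo (0 : ℝ) 1 := ⟨hp.1.1, hp.1.2.trans hb1⟩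
  have h2 : p.2 ∈ Ioo (0 : ℝ) 1 := ⟨hp.2.1, hp.2.2.trans hb1⟩
  rw [Real.norm_eq_abs, abs_of_nonneg (mul_nonneg (hU i).2.2 (globalBlock_nonneg (hU i).2.1 h1 h2))]
  exact mul_le_mul_of_nonneg_left (globalBlock_mono (hU i).2.1 hp.1.1 hp.2.1 hp.1.2.le hp.2.2.le hb1 hb1) (hU i).2.2

/-- **Continuity on sub-squares**: for unitary data with convergent expansion, `G` is jointly continuous on `(0,b)²`, `b < 1`
(`continuousOn_tsum` with the same majorant). [folklore] -/
theorem continuousOn_fourPoint_sq (hU : D.IsUnitary) (hconv : D.OpeConvergent) {b : ℝ} (hb0 : 0 < b) (hb1 : b < 1) :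
    ContinuousOn (fun p : ℝ × ℝ => D.fourPoint p.1 p.2) (Ioo (0 : ℝ) b ×ˢ Ioo (0 : ℝ) b) := by
  have hbI : b ∈ Ioo (0 : ℝ) 1 := ⟨hb0, hb1⟩
  have hsub : Ioo (0 : ℝ) b ×ˢ Ioo (0 : ℝ) b ⊆ Ioo (0 : ℝ) 1 ×ˢ Ioo (0 : ℝ) 1 :=
    prod_mono (Ioo_subset_Ioo le_rfl hb1.le) (Ioo_subset_Ioo le_rfl hb1.le)
  have hT : ContinuousOn (fun p : ℝ × ℝ => ∑' i, D.p i * globalBlock (D.Δ i) (D.spin i) p.1 p.2)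
      (Ioo (0 : ℝ) b ×ˢ Ioo (0 : ℝ) b) := by
    refine continuousOn_tsum (fun i => ?_) (hconv b b hbI hbI) fun i p hp => ?_
    · exact continuousOn_const.mul ((continuousOn_globalBlock (hU i).2.1).mono hsub)
    · have h1 : p.1 ∈ Ioo (0 : ℝ) 1 := ⟨hp.1.1, hp.1.2.trans hb1⟩
      have h2 : p.2 ∈ Ioo (0 : ℝ) 1 := ⟨hp.2.1, hp.2.2.trans hb1⟩
      rw [Real.norm_eq_abs, abs_of_nonneg (mul_nonneg (hU i).2.2 (globalBlock_nonneg (hU i).2.1 h1 h2))]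
      exact mul_le_mul_of_nonneg_left (globalBlock_mono (hU i).2.1 hp.1.1 hp.2.1 hp.1.2.le hp.2.2.le hb1 hb1) (hU i).2.2
  exact continuousOn_const.add hT

/-- **The four-point function is continuous on the open square**: for every unitary datum with convergent expansion,
`(z,z̄) ↦ G(z,z̄)` is jointly continuous on `(0,1)²` (locally, the sub-square `(0,b)²` with `b = (max(z,z̄)+1)/2`). [folklore] -/
theorem continuousOn_fourPoint (hU : D.IsUnitary) (hconv : D.OpeConvergent) :
    ContinuousOn (fun p : ℝ × ℝ => D.fourPoint p.1 p.2) (Ioo (0 : ℝ) 1 ×ˢ Ioo (0 : ℝ) 1) := by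
  refine (isOpen_Ioo.prod isOpen_Ioo).continuousOn_iff.mpr fun p hp => ?_
  have h1 : p.1 ∈ Ioo (0 : ℝ) 1 := hp.1
  have h2 : p.2 ∈ Ioo (0 : ℝ) 1 := hp.2
  have hm0 : (0 : ℝ) < max p.1 p.2 := lt_max_iff.mpr (Or.inl h1.1)
  have hm1 : max p.1 p.2 < 1 := max_lt h1.2 h2.2
  have hl : p.1 ≤ max p.1 p.2 := le_max_left _ _
  have hr : p.2 ≤ max p.1 p.2 := le_max_right _ _
  have hb0 : 0 < (max p.1 p.2 + 1) / 2 := by linarith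
  have hb1 : (max p.1 p.2 + 1) / 2 < 1 := by linarith
  refine (isOpen_Ioo.prod isOpen_Ioo).continuousOn_iff.mp (continuousOn_fourPoint_sq hU hconv hb0 hb1) ?_
  exact ⟨⟨h1.1, by linarith⟩, ⟨h2.1, by linarith⟩⟩

/-- **Continuity of `G`, hypothesis-free at `Δ_σ > 0`**: the four-point function of EVERY unitary solution of the typed sum rule at
`s > 0` is jointly continuous on the real open square (`opeConvergent_free`); the crossing identity `v^s G(z,z̄) = u^s G(1-z,1-z̄)`
(`fourPoint_crossing_free`) is an identity between continuous functions there. [cite: RattazziEtAl2008, §3] -/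
theorem continuousOn_fourPoint_free (hU : D.IsUnitary) (hC : D.SatisfiesCrossing s) (hs : 0 < s) :
    ContinuousOn (fun p : ℝ × ℝ => D.fourPoint p.1 p.2) (Ioo (0 : ℝ) 1 ×ˢ Ioo (0 : ℝ) 1) :=
  continuousOn_fourPoint hU (opeConvergent_free hU hC hs)

/-- **The diagonal restriction `x ↦ G(x,x)` is continuous on `(0,1)`** (unitary data, convergent expansion). [folklore] -/
theorem continuousOn_fourPoint_diag (hU : D.IsUnitary) (hconv : D.OpeConvergent) :
    ContinuousOn (fun x : ℝ => D.fourPoint x x) (Ioo (0 : ℝ) 1) := by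
  refine isOpen_Ioo.continuousOn_iff.mpr fun x hx => ?_
  have hb0 : 0 < (x + 1) / 2 := by linarith [hx.1]
  have hb1 : (x + 1) / 2 < 1 := by linarith [hx.2]
  have hxb : x < (x + 1) / 2 := by linarith [hx.2]
  -- the one-variable M-test on `(0, b)` with the diagonal majorant `p_i g_i(b,b)`
  have hbI : (x + 1) / 2 ∈ Ioo (0 : ℝ) 1 := ⟨hb0, hb1⟩
  have hT : ContinuousOn (fun y : ℝ => ∑' i, D.p i * globalBlock (D.Δ i) (D.spin i) y y) (Ioo (0 : ℝ) ((x + 1) / 2)) := by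
    refine continuousOn_tsum (fun i => ?_) (hconv _ _ hbI hbI) fun i y hy => ?_
    · have hm : MapsTo (fun y : ℝ => (y, y)) (Ioo (0 : ℝ) ((x + 1) / 2)) (Ioo (0 : ℝ) 1 ×ˢ Ioo (0 : ℝ) 1) :=
        fun y hy => ⟨⟨hy.1, hy.2.trans hb1⟩, ⟨hy.1, hy.2.trans hb1⟩⟩
      have hg := (continuousOn_globalBlock (hU i).2.1).comp (continuousOn_id.prodMk continuousOn_id) hm
      exact continuousOn_const.mul hg
    · have h1 : y ∈ Ioo (0 : ℝ) 1 := ⟨hy.1, hy.2.trans hb1⟩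
      rw [Real.norm_eq_abs, abs_of_nonneg (mul_nonneg (hU i).2.2 (globalBlock_nonneg (hU i).2.1 h1 h1))]
      exact mul_le_mul_of_nonneg_left (globalBlock_mono (hU i).2.1 hy.1 hy.1 hy.2.le hy.2.le hb1 hb1) (hU i).2.2
  have hG : ContinuousOn (fun y : ℝ => D.fourPoint y y) (Ioo (0 : ℝ) ((x + 1) / 2)) := continuousOn_const.add hT
  exact isOpen_Ioo.continuousOn_iff.mp hG ⟨hx.1, hxb⟩

/-- The uniform-convergence statement, hypothesis-free at `Δ_σ > 0`: the expansion of every unitary solution of the typed sum rule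
at `s > 0` converges uniformly on every sub-square `(0,b)²`, `b < 1`. [cite: PappadopuloRychkovEspinRattazzi2012PRD, §4.1] -/
theorem tendstoUniformlyOn_expansion_free (hU : D.IsUnitary) (hC : D.SatisfiesCrossing s) (hs : 0 < s) {b : ℝ}
    (hb0 : 0 < b) (hb1 : b < 1) :
    TendstoUniformlyOn (fun t : Finset D.ι => fun p : ℝ × ℝ => ∑ i ∈ t, D.p i * globalBlock (D.Δ i) (D.spin i) p.1 p.2)
      (fun p => ∑' i, D.p i * globalBlock (D.Δ i) (D.spin i) p.1 p.2) atTop (Ioo (0 : ℝ) b ×ˢ Ioo (0 : ℝ) b) :=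
  tendstoUniformlyOn_expansion hU (opeConvergent_free hU hC hs) hb0 hb1

end CrossingData

/-- **At `Δ_σ = 1/8`**: the four-point function of every unitary solution of the typed sum rule is continuous on the real open
square. CONTROL-ONLY. [folklore] -/
theorem continuousOn_fourPoint_eighth (D : CrossingData) (hU : D.IsUnitary) (hC : D.SatisfiesCrossing (1 / 8)) :
    ContinuousOn (fun p : ℝ × ℝ => D.fourPoint p.1 p.2) (Ioo (0 : ℝ) 1 ×ˢ Ioo (0 : ℝ) 1) :=
  CrossingData.continuousOn_fourPoint_free hU hC (by norm_num)

end Summit.CriticalPhenomena.Ising3D.Control2D
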